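import Literature.AnabelianGeometry.EtaleTheta.ThetaCoversHeisenbergGroup
import Mathlib.Tactic.LinearCombination

/-!
# The finite Heisenberg toy WITH A KUMMER TWIST `(ℤ/l × ℤ/l × ℤ/l) ⋊ D_l` (group-theoretic substrate of a
# second non-vacuity witness for [EtTh] §2 — one with a NON-trivial Galois group `G_K = ℤ/l`)

Mochizuki, *The Étale Theta Function and its Frobenioid-theoretic Manifestations* [EtTh], Publ. RIMS
45 (2009), §2, Def 2.1 – Cor 2.9, PRIMS text pp.35–43 (bib key `MochizukiEtTh2009`): there `G_K` acts on
`Δ̄^ell_X ≅ E[l]` unipotently through the Kummer class of the `q`-parameter, and the decomposition group `D_x`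
of the cusp is far from normal.

This file is PURE FINITE GROUP THEORY (no claim about print): the group
`kumPiC l := (ℤ/l × ℤ/l × ℤ/l) ⋊ D_l`, coordinates `(x, y, z)` = exponents of `b` (the `μ_l`-line of
`Δ̄^ell`), `c` (the centre `Δ̄_Θ`, written with a DOUBLED coordinate so that no division by `2` occurs) and
`g` (a generator of `G_K = ℤ/l`); the dihedral group `D_l = ⟨r, s⟩` acts by
`r^i · (x, y, z) = (x − i z, y + 2 i x − i(i−1) z, z)` and `s r^i · (x, y, z) = (−x + (i−1) z, y + 2 i x − i(i−1) z, z)`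
(`act`, `theta`) — on the plane `z = 0` this is abc-iut-w5-d243's Heisenberg toy `ThetaCoversHeisenbergGroup`
(with `c` doubled), and the `z`-direction records the 1-cocycle `D_l → (ℤ/l)²`, `r, s ↦ (−1, 0)`, whose class
generates `H¹(D_l, (ℤ/l)²) ≅ ℤ/l`: conjugation by `g` moves `r` by `b` ("`G_K` acts on `E[l]` by `(1 κ; 0 1)`").
Coordinates `ξ = x`, `υ = y`, `ζ = z` with their cocycle rules; `ζ` is a homomorphism (the augmentation to
`G_K`). Consumers: `ThetaCoversKummerTwistSubgroups.lean`, the tempered model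
`ThetaCoversKummerTwistTemperedDefs.lean` (abc-iut cell, seat abc-iut-f-141; FACT-LIST row F-0601). [folklore]
-/

namespace Literature.AnabelianGeometry.EtaleTheta

namespace ThetaCovers

namespace KummerWitness

open Multiplicative HeisenbergWitness

variable (l : ℕ)

/-! ## 1. The action of `D_l` on `(ℤ/l)³` and the group -/

/-- The affine-unipotent maps `(x, y, z) ↦ (ε x + a z, y + 2 i x + q z, z)` of `(ℤ/l)³` underlying the
`D_l`-action. (toy bookkeeping; no claim about print) [cite: MochizukiEtTh2009, Def 2.1 p.36] -/
def actFun (ε i a q : ZMod l) (p : ZMod l × ZMod l × ZMod l) : ZMod l × ZMod l × ZMod l :=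
  (ε * p.1 + a * p.2.2, p.2.1 + 2 * i * p.1 + q * p.2.2, p.2.2)

/-- Composition law: `act(ε,i,a,q) ∘ act(ε',i',a',q') = act(εε', i' + iε', εa' + a, q + q' + 2 i a')`.
(toy bookkeeping; no claim about print) [cite: MochizukiEtTh2009, Def 2.1 p.36] -/
theorem actFun_actFun (ε i a q ε' i' a' q' : ZMod l) (p : ZMod l × ZMod l × ZMod l) :
    actFun l ε i a q (actFun l ε' i' a' q' p) =
      actFun l (ε * ε') (i' + i * ε') (ε * a' + a) (q + q' + 2 * i * a') p := by
  unfold actFun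
  ext <;> simp only <;> ring

/-- `act(1, 0, 0, 0)` is the identity. (toy bookkeeping; no claim about print) [cite: MochizukiEtTh2009, Def 2.1 p.36] -/
theorem actFun_one (p : ZMod l × ZMod l × ZMod l) : actFun l 1 0 0 0 p = p := by
  unfold actFun
  ext <;> simp

/-- Congruence helper for `actFun`. (toy bookkeeping; no claim about print) [cite: MochizukiEtTh2009, Def 2.1 p.36] -/
theorem actFun_congr {ε i a q ε' i' a' q' : ZMod l} (h1 : ε = ε') (h2 : i = i') (h3 : a = a') (h4 : q = q')
    (p : ZMod l × ZMod l × ZMod l) : actFun l ε i a q p = actFun l ε' i' a' q' p := by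
  subst h1; subst h2; subst h3; subst h4; rfl

/-- The map `act(u, i, a, q)` for a unit `u`, as an automorphism of the multiplicative copy of `(ℤ/l)³`
(inverse `act(u⁻¹, −i u⁻¹, −u⁻¹ a, −q + 2 i u⁻¹ a)`). (toy bookkeeping; no claim about print)
[cite: MochizukiEtTh2009, Def 2.1 p.36] -/
def act (u : (ZMod l)ˣ) (i a q : ZMod l) : MulAut (Multiplicative (ZMod l × ZMod l × ZMod l)) where
  toFun x := ofAdd (actFun l (u : ZMod l) i a q x.toAdd)
  invFun x := ofAdd (actFun l (↑u⁻¹ : ZMod l) (-(i * ↑u⁻¹)) (-(↑u⁻¹ * a)) (-q + 2 * i * ↑u⁻¹ * a) x.toAdd)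
  left_inv x := by
    apply toAdd.injective
    simp only [toAdd_ofAdd, actFun_actFun]
    have hu : ((↑u⁻¹ : ZMod l) * ↑u) = 1 := Units.inv_mul u
    rw [actFun_congr l (ε' := 1) (i' := 0) (a' := 0) (q' := 0) hu (by linear_combination (-i) * hu)
      (by ring) (by ring), actFun_one]
  right_inv x := by
    apply toAdd.injective
    simp only [toAdd_ofAdd, actFun_actFun]
    have hu : ((↑u : ZMod l) * ↑u⁻¹) = 1 := Units.mul_inv u
    rw [actFun_congr l (ε' := 1) (i' := 0) (a' := 0) (q' := 0) hu (by ring)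
      (by linear_combination (-a) * hu) (by ring), actFun_one]
  map_mul' x y := by
    apply toAdd.injective
    simp only [toAdd_ofAdd, toAdd_mul, actFun, Prod.fst_add, Prod.snd_add, Prod.mk_add_mk]
    ext <;> simp only <;> ring

/-- First coordinate of the action: `x ↦ u x + a z`. (toy bookkeeping; no claim about print) [cite: MochizukiEtTh2009, Def 2.1 p.36] -/
@[simp] theorem toAdd_act_fst (u : (ZMod l)ˣ) (i a q : ZMod l) (x : Multiplicative (ZMod l × ZMod l × ZMod l)) :
    (toAdd (act l u i a q x)).1 = (u : ZMod l) * (toAdd x).1 + a * (toAdd x).2.2 := rfl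

/-- Second coordinate of the action: `y ↦ y + 2 i x + q z`. (toy bookkeeping; no claim about print) [cite: MochizukiEtTh2009, Def 2.1 p.36] -/
@[simp] theorem toAdd_act_snd_fst (u : (ZMod l)ˣ) (i a q : ZMod l) (x : Multiplicative (ZMod l × ZMod l × ZMod l)) :
    (toAdd (act l u i a q x)).2.1 = (toAdd x).2.1 + 2 * i * (toAdd x).1 + q * (toAdd x).2.2 := rfl

/-- Third coordinate of the action: `z ↦ z`. (toy bookkeeping; no claim about print) [cite: MochizukiEtTh2009, Def 2.1 p.36] -/
@[simp] theorem toAdd_act_snd_snd (u : (ZMod l)ˣ) (i a q : ZMod l) (x : Multiplicative (ZMod l × ZMod l × ZMod l)) :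
    (toAdd (act l u i a q x)).2.2 = (toAdd x).2.2 := rfl

/-- Composition law in `MulAut`. (toy bookkeeping; no claim about print) [cite: MochizukiEtTh2009, Def 2.1 p.36] -/
theorem act_mul_act (u u' : (ZMod l)ˣ) (i a q i' a' q' : ZMod l) :
    act l u i a q * act l u' i' a' q' = act l (u * u') (i' + i * u') (u * a' + a) (q + q' + 2 * i * a') := by
  ext x : 1
  apply toAdd.injective
  change actFun l (u : ZMod l) i a q (actFun l (u' : ZMod l) i' a' q' x.toAdd) =
    actFun l ((u * u' : (ZMod l)ˣ) : ZMod l) (i' + i * u') (u * a' + a) (q + q' + 2 * i * a') x.toAdd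
  rw [actFun_actFun, Units.val_mul]

/-- Congruence helper for `act`. (toy bookkeeping; no claim about print) [cite: MochizukiEtTh2009, Def 2.1 p.36] -/
theorem act_congr {u u' : (ZMod l)ˣ} {i a q i' a' q' : ZMod l} (hu : u = u') (hi : i = i') (ha : a = a')
    (hq : q = q') : act l u i a q = act l u' i' a' q' := by
  subst hu; subst hi; subst ha; subst hq; rfl

/-- The `D_l`-action: `r^i ↦ act(1, i, −i, −i(i−1))`, `s r^i ↦ act(−1, i, i−1, −i(i−1))`.
(toy bookkeeping; no claim about print) [cite: MochizukiEtTh2009, Def 2.1 p.36] -/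
def theta : DihedralGroup l →* MulAut (Multiplicative (ZMod l × ZMod l × ZMod l)) where
  toFun g := match g with
    | DihedralGroup.r i => act l 1 i (-i) (-(i * (i - 1)))
    | DihedralGroup.sr i => act l (-1) i (i - 1) (-(i * (i - 1)))
  map_one' := by
    rw [DihedralGroup.one_def]
    ext x : 1
    apply toAdd.injective
    change actFun l ((1 : (ZMod l)ˣ) : ZMod l) 0 (-0) (-(0 * (0 - 1))) x.toAdd = x.toAdd
    rw [Units.val_one, actFun_congr l (ε' := 1) (i' := 0) (a' := 0) (q' := 0) rfl rfl neg_zero (by ring), actFun_one]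
  map_mul' g h := by
    rcases g with i | i <;> rcases h with j | j
    · simp only [DihedralGroup.r_mul_r, act_mul_act]
      exact act_congr l (by simp) (by simp only [Units.val_one]; ring) (by simp only [Units.val_one]; ring) (by ring)
    · simp only [DihedralGroup.r_mul_sr, act_mul_act]
      exact act_congr l (by simp) (by simp only [Units.val_neg, Units.val_one]; ring)
        (by simp only [Units.val_one]; ring) (by ring)
    · simp only [DihedralGroup.sr_mul_r, act_mul_act]
      exact act_congr l (by simp) (by simp only [Units.val_one]; ring) (by simp only [Units.val_neg, Units.val_one]; ring)
        (by ring)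
    · simp only [DihedralGroup.sr_mul_sr, act_mul_act]
      exact act_congr l (by simp) (by simp only [Units.val_neg, Units.val_one]; ring)
        (by simp only [Units.val_neg, Units.val_one]; ring) (by ring)

/-- `theta` on a rotation. (toy bookkeeping; no claim about print) [cite: MochizukiEtTh2009, Def 2.1 p.36] -/
@[simp] theorem theta_r (i : ZMod l) : theta l (DihedralGroup.r i) = act l 1 i (-i) (-(i * (i - 1))) := rfl

/-- `theta` on a reflection. (toy bookkeeping; no claim about print) [cite: MochizukiEtTh2009, Def 2.1 p.36] -/
@[simp] theorem theta_sr (i : ZMod l) :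
    theta l (DihedralGroup.sr i) = act l (-1) i (i - 1) (-(i * (i - 1))) := rfl

/-- **`Π_C` of the twisted toy**: `(ℤ/l × ℤ/l × ℤ/l) ⋊ D_l`. (toy bookkeeping; no claim about print)
[cite: MochizukiEtTh2009, Def 2.1 p.36] -/
abbrev kumPiC : Type := Multiplicative (ZMod l × ZMod l × ZMod l) ⋊[theta l] DihedralGroup l

/-- The coefficient `a(g)` of `z` in the first coordinate of the action: `a(r^i) = −i`, `a(s r^i) = i − 1`.
(toy bookkeeping; no claim about print) [cite: MochizukiEtTh2009, Def 2.1 p.36] -/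
def aPar : DihedralGroup l → ZMod l
  | DihedralGroup.r i => -i
  | DihedralGroup.sr i => i - 1

/-- `a(r^i) = −i`. (toy bookkeeping; no claim about print) [cite: MochizukiEtTh2009, Def 2.1 p.36] -/
@[simp] theorem aPar_r (i : ZMod l) : aPar l (DihedralGroup.r i) = -i := rfl

/-- `a(s r^i) = i − 1`. (toy bookkeeping; no claim about print) [cite: MochizukiEtTh2009, Def 2.1 p.36] -/
@[simp] theorem aPar_sr (i : ZMod l) : aPar l (DihedralGroup.sr i) = i - 1 := rfl

/-- `a(1) = 0`. (toy bookkeeping; no claim about print) [cite: MochizukiEtTh2009, Def 2.1 p.36] -/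
@[simp] theorem aPar_one : aPar l 1 = 0 := by
  rw [DihedralGroup.one_def]; exact neg_zero

/-- The coefficient `q(g) = −i(i−1)` (`i` the rotation index) of `z` in the second coordinate.
(toy bookkeeping; no claim about print) [cite: MochizukiEtTh2009, Def 2.1 p.36] -/
def qPar (g : DihedralGroup l) : ZMod l := -(rotIdx l g * (rotIdx l g - 1))

/-- `q(1) = 0`. (toy bookkeeping; no claim about print) [cite: MochizukiEtTh2009, Def 2.1 p.36] -/
@[simp] theorem qPar_one : qPar l 1 = 0 := by simp [qPar]

/-- First coordinate of `theta g`: `x ↦ ε(g) x + a(g) z`. (toy bookkeeping; no claim about print)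
[cite: MochizukiEtTh2009, Def 2.1 p.36] -/
@[simp] theorem toAdd_theta_fst (g : DihedralGroup l) (x : Multiplicative (ZMod l × ZMod l × ZMod l)) :
    (toAdd (theta l g x)).1 = eps l g * (toAdd x).1 + aPar l g * (toAdd x).2.2 := by
  rcases g with i | i <;> simp

/-- Second coordinate of `theta g`: `y ↦ y + 2 rotIdx(g) x + q(g) z`. (toy bookkeeping; no claim about print)
[cite: MochizukiEtTh2009, Def 2.1 p.36] -/
@[simp] theorem toAdd_theta_snd_fst (g : DihedralGroup l) (x : Multiplicative (ZMod l × ZMod l × ZMod l)) :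
    (toAdd (theta l g x)).2.1 = (toAdd x).2.1 + 2 * rotIdx l g * (toAdd x).1 + qPar l g * (toAdd x).2.2 := by
  rcases g with i | i <;> simp [qPar]

/-- Third coordinate of `theta g`: `z ↦ z`. (toy bookkeeping; no claim about print) [cite: MochizukiEtTh2009, Def 2.1 p.36] -/
@[simp] theorem toAdd_theta_snd_snd (g : DihedralGroup l) (x : Multiplicative (ZMod l × ZMod l × ZMod l)) :
    (toAdd (theta l g x)).2.2 = (toAdd x).2.2 := by
  rcases g with i | i <;> simp

/-! ## 2. Coordinates `ξ = x`, `υ = y`, `ζ = z` -/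

/-- The coordinate `x` (exponent of `b`) of an element of `Π_C`. (toy bookkeeping; no claim about print)
[cite: MochizukiEtTh2009, Def 2.1 p.36] -/
def ξ (g : kumPiC l) : ZMod l := (toAdd g.left).1

/-- The coordinate `y` (doubled exponent of `c`) of an element of `Π_C`. (toy bookkeeping; no claim about print)
[cite: MochizukiEtTh2009, Def 2.1 p.36] -/
def υ (g : kumPiC l) : ZMod l := (toAdd g.left).2.1

/-- The coordinate `z` (exponent of `g`, the Galois coordinate) of an element of `Π_C`. (toy bookkeeping; no
claim about print) [cite: MochizukiEtTh2009, Def 2.1 p.36] -/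
def ζ (g : kumPiC l) : ZMod l := (toAdd g.left).2.2

/-- Cocycle rule for `x`: `x(gh) = x(g) + ε(g) x(h) + a(g) z(h)`. (toy bookkeeping; no claim about print)
[cite: MochizukiEtTh2009, Def 2.1 p.36] -/
@[simp] theorem ξ_mul (g h : kumPiC l) : ξ l (g * h) = ξ l g + (eps l g.right * ξ l h + aPar l g.right * ζ l h) := by
  simp [ξ, ζ, SemidirectProduct.mul_left, toAdd_mul]

/-- Cocycle rule for `y`: `y(gh) = y(g) + y(h) + 2 rotIdx(g) x(h) + q(g) z(h)`. (toy bookkeeping; no claim about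
print) [cite: MochizukiEtTh2009, Def 2.1 p.36] -/
@[simp] theorem υ_mul (g h : kumPiC l) :
    υ l (g * h) = υ l g + (υ l h + 2 * rotIdx l g.right * ξ l h + qPar l g.right * ζ l h) := by
  simp [υ, ξ, ζ, SemidirectProduct.mul_left, toAdd_mul]

/-- `z` is additive: `z(gh) = z(g) + z(h)`. (toy bookkeeping; no claim about print) [cite: MochizukiEtTh2009, Def 2.1 p.36] -/
@[simp] theorem ζ_mul (g h : kumPiC l) : ζ l (g * h) = ζ l g + ζ l h := by
  simp [ζ, SemidirectProduct.mul_left, toAdd_mul]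

/-- `x(1) = 0`. (toy bookkeeping; no claim about print) [cite: MochizukiEtTh2009, Def 2.1 p.36] -/
@[simp] theorem ξ_one : ξ l 1 = 0 := by simp [ξ]

/-- `y(1) = 0`. (toy bookkeeping; no claim about print) [cite: MochizukiEtTh2009, Def 2.1 p.36] -/
@[simp] theorem υ_one : υ l 1 = 0 := by simp [υ]

/-- `z(1) = 0`. (toy bookkeeping; no claim about print) [cite: MochizukiEtTh2009, Def 2.1 p.36] -/
@[simp] theorem ζ_one : ζ l 1 = 0 := by simp [ζ]

/-- `z` of an inverse. (toy bookkeeping; no claim about print) [cite: MochizukiEtTh2009, Def 2.1 p.36] -/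
@[simp] theorem ζ_inv (g : kumPiC l) : ζ l g⁻¹ = -ζ l g := by
  show (toAdd (theta l g.right⁻¹ g.left⁻¹)).2.2 = _
  rw [toAdd_theta_snd_snd, toAdd_inv]
  simp only [Prod.snd_neg, ζ]

/-- `x` of an inverse. (toy bookkeeping; no claim about print) [cite: MochizukiEtTh2009, Def 2.1 p.36] -/
@[simp] theorem ξ_inv (g : kumPiC l) : ξ l g⁻¹ = -(eps l g.right * ξ l g) - aPar l g.right⁻¹ * ζ l g := by
  show (toAdd (theta l g.right⁻¹ g.left⁻¹)).1 = _
  rw [toAdd_theta_fst, toAdd_inv, eps_inv]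
  simp only [Prod.fst_neg, Prod.snd_neg, ξ, ζ]
  ring

/-- `y` of an inverse. (toy bookkeeping; no claim about print) [cite: MochizukiEtTh2009, Def 2.1 p.36] -/
@[simp] theorem υ_inv (g : kumPiC l) :
    υ l g⁻¹ = -υ l g - 2 * rotIdx l g.right⁻¹ * ξ l g - qPar l g.right⁻¹ * ζ l g := by
  show (toAdd (theta l g.right⁻¹ g.left⁻¹)).2.1 = _
  rw [toAdd_theta_snd_fst, toAdd_inv]
  simp only [Prod.fst_neg, Prod.snd_neg, ξ, υ, ζ]
  ring

/-- `x (inl n) = n.1`. (toy bookkeeping; no claim about print) [cite: MochizukiEtTh2009, Def 2.1 p.36] -/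
@[simp] theorem ξ_inl (n : Multiplicative (ZMod l × ZMod l × ZMod l)) :
    ξ l (SemidirectProduct.inl n) = (toAdd n).1 := rfl

/-- `y (inl n) = n.2.1`. (toy bookkeeping; no claim about print) [cite: MochizukiEtTh2009, Def 2.1 p.36] -/
@[simp] theorem υ_inl (n : Multiplicative (ZMod l × ZMod l × ZMod l)) :
    υ l (SemidirectProduct.inl n) = (toAdd n).2.1 := rfl

/-- `z (inl n) = n.2.2`. (toy bookkeeping; no claim about print) [cite: MochizukiEtTh2009, Def 2.1 p.36] -/
@[simp] theorem ζ_inl (n : Multiplicative (ZMod l × ZMod l × ZMod l)) :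
    ζ l (SemidirectProduct.inl n) = (toAdd n).2.2 := rfl

/-- `x (inr g) = 0`. (toy bookkeeping; no claim about print) [cite: MochizukiEtTh2009, Def 2.1 p.36] -/
@[simp] theorem ξ_inr (g : DihedralGroup l) : ξ l (SemidirectProduct.inr g) = 0 := by simp [ξ]

/-- `y (inr g) = 0`. (toy bookkeeping; no claim about print) [cite: MochizukiEtTh2009, Def 2.1 p.36] -/
@[simp] theorem υ_inr (g : DihedralGroup l) : υ l (SemidirectProduct.inr g) = 0 := by simp [υ]

/-- `z (inr g) = 0`. (toy bookkeeping; no claim about print) [cite: MochizukiEtTh2009, Def 2.1 p.36] -/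
@[simp] theorem ζ_inr (g : DihedralGroup l) : ζ l (SemidirectProduct.inr g) = 0 := by simp [ζ]

/-- An element of `Π_C` is determined by `(x, y, z)` and its `D_l`-component. (toy bookkeeping; no claim about
print) [cite: MochizukiEtTh2009, Def 2.1 p.36] -/
theorem ext_of_coords {g h : kumPiC l} (h1 : g.right = h.right) (h2 : ξ l g = ξ l h) (h3 : υ l g = υ l h)
    (h4 : ζ l g = ζ l h) : g = h := by
  refine SemidirectProduct.ext ?_ h1
  apply toAdd.injective
  exact Prod.ext h2 (Prod.ext h3 h4)

/-- … in particular it is `1` iff all four coordinates vanish. (toy bookkeeping; no claim about print)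
[cite: MochizukiEtTh2009, Def 2.1 p.36] -/
theorem eq_one_of_coords {g : kumPiC l} (h1 : g.right = 1) (h2 : ξ l g = 0) (h3 : υ l g = 0) (h4 : ζ l g = 0) :
    g = 1 :=
  ext_of_coords l (by simpa using h1) (by simpa using h2) (by simpa using h3) (by simpa using h4)

/-- The element `b^x c^y g^z · d` of `Π_C` with prescribed coordinates. (toy bookkeeping; no claim about print)
[cite: MochizukiEtTh2009, Def 2.1 p.36] -/
def mk (x y z : ZMod l) (d : DihedralGroup l) : kumPiC l := ⟨ofAdd (x, y, z), d⟩

/-- Coordinates of `mk`. (toy bookkeeping; no claim about print) [cite: MochizukiEtTh2009, Def 2.1 p.36] -/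
@[simp] theorem mk_right (x y z : ZMod l) (d : DihedralGroup l) : (mk l x y z d).right = d := rfl

/-- Coordinates of `mk`. (toy bookkeeping; no claim about print) [cite: MochizukiEtTh2009, Def 2.1 p.36] -/
@[simp] theorem ξ_mk (x y z : ZMod l) (d : DihedralGroup l) : ξ l (mk l x y z d) = x := rfl

/-- Coordinates of `mk`. (toy bookkeeping; no claim about print) [cite: MochizukiEtTh2009, Def 2.1 p.36] -/
@[simp] theorem υ_mk (x y z : ZMod l) (d : DihedralGroup l) : υ l (mk l x y z d) = y := rfl

/-- Coordinates of `mk`. (toy bookkeeping; no claim about print) [cite: MochizukiEtTh2009, Def 2.1 p.36] -/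
@[simp] theorem ζ_mk (x y z : ZMod l) (d : DihedralGroup l) : ζ l (mk l x y z d) = z := rfl

/-- `ζ` as a homomorphism `Π_C → ℤ/l` — the augmentation onto the toy's Galois group `G_K = ℤ/l`.
(toy bookkeeping; no claim about print) [cite: MochizukiEtTh2009, Def 2.1 p.36] -/
def aug : kumPiC l →* Multiplicative (ZMod l) where
  toFun g := ofAdd (ζ l g)
  map_one' := by simp
  map_mul' g h := by simp [ofAdd_add]

/-- `aug g = ofAdd (z g)`. (toy bookkeeping; no claim about print) [cite: MochizukiEtTh2009, Def 2.1 p.36] -/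
@[simp] theorem aug_apply (g : kumPiC l) : aug l g = ofAdd (ζ l g) := rfl

/-- `g ∈ Ker(aug)` iff `z(g) = 0`. (toy bookkeeping; no claim about print) [cite: MochizukiEtTh2009, Def 2.1 p.36] -/
theorem mem_ker_aug {g : kumPiC l} : g ∈ (aug l).ker ↔ ζ l g = 0 := by
  rw [MonoidHom.mem_ker, aug_apply]
  exact ⟨fun h => by simpa using congrArg toAdd h, fun h => by rw [h]; rfl⟩

/-- `aug` is onto (the element `g^z`). (toy bookkeeping; no claim about print) [cite: MochizukiEtTh2009, Def 2.1 p.36] -/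
theorem aug_surjective : Function.Surjective (aug l) := fun t =>
  ⟨mk l 0 0 (toAdd t) 1, by simp⟩

end KummerWitness

end ThetaCovers

end Literature.AnabelianGeometry.EtaleTheta
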